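import Summits.Ventures.HSemireg.WedgeHankelTwoFiniteNodes
import Summits.Ventures.HSemireg.WedgeHankelDivisorTopGeneric
import Summits.Ventures.HSemireg.WedgeHankelNodeImageTop

/-!
# Venture HSemireg — THE IMAGE AT TWO FINITE NODES, NAMED: for `λ ≠ μ` and exact orders `P, P′` with `P + P′ + 2 ≤ min(k′+1, n+1−k′)`,
# `V(univ, w_n(expMul λ q₁ + expMul μ q₂), k′) = Gs λ μ ((coSiegel ⊓ xRich(n+k′, n−P−1)) ⊔ (coSiegel ⊓ yRich(n+k′, n−P′−1)))` — F1's two-frame automorphism on the `(0, ∞)` image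

HONEST FRAMING. Part of the Lean index of the computation cell `pub-hsemireg` (seat p10 gen 16, Sunday typer «UNIFORM-IN-n»).
Finite-dimensional EXTERIOR ALGEBRA over a field ONLY: no variety, no cohomology theory, no sheaf, no Ext group, no semiregularity map;
nothing here says that HC / HC_CM / HC_AV holds; no Literature fact is declared or used.  The dictionary is QUOTED, never asserted.

WHAT IS IN THE TREE / KEYED.  F1 (`Gs λ μ`, `w_expMul_add_expMul_eq_Gs`: the class is the `Gs`-image of a `(0, ∞)` two-node class; kernels transported `Kr_Gs`), F3c (`V_w_expMul_sum_add_rev`: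
the image of a `P¹` divisor class is the sum of its node images), F4b/F7 (node images NAMED at `0` and at `∞`).  THIS FILE (namespace `Summit.Ventures.HSemireg.Wedge.HankelFrameChange`
continued): `V_Ls`, **`V_Gs`** (images are transported by the lower shear and the two-frame automorphism); `V_w_node_zero_add_rev_eq` (the `(0, ∞)` image named: `(coSiegel ⊓ xRich) ⊔
(coSiegel ⊓ yRich)`); **`V_w_two_finite_nodes_eq`** (the statement in the title).  Class side only; new names only.
-/

open Module

namespace Summit.Ventures.HSemireg.Wedge.HankelFrameChange

open Summit.Ventures.HSemireg.Wedge Summit.Ventures.HSemireg.Wedge.Kunneth Summit.Ventures.HSemireg.Wedge.Hankel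
  Summit.Ventures.HSemireg.Wedge.BasisFree Summit.Ventures.HSemireg.Wedge.HankelSiegel Summit.Ventures.HSemireg.Wedge.HankelSiegelIdeal
  Summit.Ventures.HSemireg.Wedge.KunnethKernel Summit.Ventures.HSemireg.Wedge.KernelDuality

variable (K : Type*) [Field K] {n : ℕ}

/-- images are transported by the swap (E7's `V_mapEquiv`). -/
lemma V_Ψs (f : HT K (In n)) (k : ℕ) : V K (In n) Finset.univ (Ψs K f) k = (V K (In n) Finset.univ f k).map (Ψs K (n := n)).toLinearMap :=
  V_mapEquiv K _ f k

/-- **`V(univ, Ls c f, k) = Ls c (V(univ, f, k))`.** -/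
theorem V_Ls (c : K) (f : HT K (In n)) (k : ℕ) : V K (In n) Finset.univ (Ls K c f) k = (V K (In n) Finset.univ f k).map (Ls K (n := n) c).toLinearMap := by
  rw [Ls_apply, V_Ψs, V_Φs, V_Ψs]
  show _ = (V K (In n) Finset.univ f k).map (((Ψs K (n := n)).trans (Φs K c)).trans (Ψs K)).toLinearMap
  rw [map_trans_eq, map_trans_eq]

/-- **`V(univ, Gs λ μ f, k) = Gs λ μ (V(univ, f, k))`.** -/
theorem V_Gs (lam mu : K) (f : HT K (In n)) (k : ℕ) :
    V K (In n) Finset.univ (Gs K lam mu f) k = (V K (In n) Finset.univ f k).map (Gs K (n := n) lam mu).toLinearMap := by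
  rw [Gs_apply, V_Φs, V_Ls]
  show _ = (V K (In n) Finset.univ f k).map ((Ls K (mu - lam)⁻¹).trans (Φs K lam)).toLinearMap
  rw [map_trans_eq]

/-- **THE `(0, ∞)` IMAGE, NAMED**: for `q₀` of exact order `P` and `q∞` of exact order `P′` with `P + P′ + 2 ≤ k′ + 1`, `≤ n + 1 − k′`, `P, P′ < n`, `k + k′ = n`:
`V(univ, w_n(q₀ + rev_n q∞), k′) = (coSiegel(k′+n) ⊓ xRich(k′+n, n−P−1)) ⊔ (coSiegel(k′+n) ⊓ yRich(k′+n, n−P′−1))` (F3c's sum law with F4b/F7's node names). -/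
theorem V_w_node_zero_add_rev_eq {k k' P P' : ℕ} (hkk' : k + k' = n) (hPn : P < n) (hP'n : P' < n) {q₀ qinf : ℕ → K}
    (hq : ∀ j, P < j → q₀ j = 0) (hqP : q₀ P ≠ 0) (hqi : ∀ j, P' < j → qinf j = 0) (hqiP : qinf P' ≠ 0)
    (hDk : P + P' + 2 ≤ k' + 1) (hDn : P + P' + 2 ≤ n + 1 - k') :
    V K (In n) Finset.univ (w K n n (fun j => q₀ j + rev K n qinf j)) k' =
      (coSiegel K n (k' + n) ⊓ xRich K n (k' + n) (n - P - 1)) ⊔ (coSiegel K n (k' + n) ⊓ yRich K n (k' + n) (n - P' - 1)) := by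
  have hlam : Function.Injective (fun _ : Fin 1 => (0 : K)) := fun a b _ => Subsingleton.elim a b
  have e : (fun j => q₀ j + rev K n qinf j) = fun j => (∑ i : Fin 1, expMul K ((fun _ : Fin 1 => (0 : K)) i) ((fun _ : Fin 1 => q₀) i) j) + rev K n qinf j := by
    funext j; simp [expMul_zero_left]
  have hsum : ∑ i : Fin 1, ((fun _ : Fin 1 => P) i + 1) = P + 1 := by simp
  rw [e, (V_w_expMul_sum_add_rev K hlam (P := fun _ : Fin 1 => P) (fun i j hj => hq j hj) (fun i => hqP) hqi hqiP
      (by rw [hsum]; omega) (by rw [hsum]; omega)).1, iSup_unique]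
  show V K (In n) Finset.univ (w K n n (expMul K 0 q₀)) k' ⊔ _ = _
  rw [show expMul K 0 q₀ = q₀ from funext (expMul_zero_left K q₀), V_w_of_order_eq K hkk' (by omega) hPn hq hqP,
    V_w_rev_of_order_eq K hkk' (by omega) hP'n hqi hqiP]

/-- **THE IMAGE AT TWO FINITE NODES, NAMED**: `λ ≠ μ`, `q₁` of exact order `P`, `q₂` of exact order `P′`, `P + P′ + 2 ≤ k′ + 1`, `≤ n + 1 − k′`, `P, P′ < n`, `k + k′ = n` ⇒
**`V(univ, w_n(expMul λ q₁ + expMul μ q₂), k′) = Gs λ μ ((coSiegel ⊓ xRich(k′+n, n−P−1)) ⊔ (coSiegel ⊓ yRich(k′+n, n−P′−1)))`** — the co-Siegel forms with at least `n − P` letters from the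
frame `{x_a + λ y_a}` plus those with at least `n − P′` letters from the frame `{x_a + μ y_a}`, in F1's two-frame coordinates. -/
theorem V_w_two_finite_nodes_eq {lam mu : K} (h : lam ≠ mu) {k k' P P' : ℕ} (hkk' : k + k' = n) (hPn : P < n) (hP'n : P' < n) {q₁ q₂ : ℕ → K}
    (hq₁ : ∀ j, P < j → q₁ j = 0) (hq₁P : q₁ P ≠ 0) (hq₂ : ∀ j, P' < j → q₂ j = 0) (hq₂P : q₂ P' ≠ 0)
    (hDk : P + P' + 2 ≤ k' + 1) (hDn : P + P' + 2 ≤ n + 1 - k') :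
    V K (In n) Finset.univ (w K n n (fun j => expMul K lam q₁ j + expMul K mu q₂ j)) k' =
      ((coSiegel K n (k' + n) ⊓ xRich K n (k' + n) (n - P - 1)) ⊔ (coSiegel K n (k' + n) ⊓ yRich K n (k' + n) (n - P' - 1))).map
        (Gs K (n := n) lam mu).toLinearMap := by
  have hd : mu - lam ≠ 0 := sub_ne_zero.mpr (Ne.symm h)
  have hc : -(mu - lam)⁻¹ ≠ 0 := neg_ne_zero.mpr (inv_ne_zero hd)
  -- the preimage (0, ∞) class: r₁ (node 0, order P) + s (top window, order P′); s agrees with rev_n (rev_n s) on [0, n]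
  set r₁ : ℕ → K := lowMul K n (-(mu - lam)⁻¹) q₁ with hr₁
  set s : ℕ → K := scaleSeq K (mu - lam) (rev K n (scaleSeq K (-(mu - lam)⁻¹) (lowMul K n (mu - lam)⁻¹ q₂))) with hs
  have hr₁0 : ∀ j, P < j → r₁ j = 0 := fun j hj => lowMul_apply_eq_zero K _ hq₁ hj
  have hr₁P : r₁ P ≠ 0 := by rw [hr₁, lowMul_apply_self K _ (by omega) hq₁]; exact hq₁P
  have hs0 : ∀ j, j < n - P' → s j = 0 := fun j hj => topWindow_apply_eq_zero K hq₂ hj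
  have hsP : s (n - P') ≠ 0 := by
    rw [hs, topWindow_apply_sub K (by omega) hq₂]
    exact mul_ne_zero (pow_ne_zero _ hd) (mul_ne_zero (pow_ne_zero _ hc) hq₂P)
  -- rev_n s is a node-0 sequence of exact order P′, and s ≡ rev_n (rev_n s) on [0, n]
  have hrs0 : ∀ j, P' < j → rev K n s j = 0 := by
    intro j hj
    by_cases hjn : j ≤ n
    · rw [rev_apply_of_le K hjn]; exact hs0 _ (by omega)
    · exact rev_apply_of_lt K (by omega) _
  have hrsP : rev K n s P' ≠ 0 := by rw [rev_apply_of_le K (by omega)]; exact hsP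
  have ew : w K n n (fun j => r₁ j + s j) = w K n n (fun j => r₁ j + rev K n (rev K n s) j) := by
    rw [w_add, w_add, w_rev_rev]
  rw [w_expMul_add_expMul_eq_Gs K h, V_Gs, ew, V_w_node_zero_add_rev_eq K hkk' hPn hP'n hr₁0 hr₁P hrs0 hrsP hDk hDn]

end Summit.Ventures.HSemireg.Wedge.HankelFrameChange
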